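import Mathlib
import Summits.Ventures.DiscreteObjects.Mahler.SubLehmerDegreeTwenty
import Summits.Ventures.DiscreteObjects.Mahler.CensusKernelDeg20Final
import Summits.Ventures.DiscreteObjects.Mahler.CensusListedLehmerMinimum

/-!
# Lehmer's conjecture for every integer polynomial of degree ≤ 21, in the kernel (venture `DiscreteObjects`, target L)

Cell `pub-namedobj`, seat `pub-namedobj-mahler-g16`. Framing: lottery ticket; floor = certified bounds/negative ranges.

The degree-20 kernel census row `degreeCensus_twenty` (49 cores = 35 primitive + 14 imprimitive, among them Lehmer's
polynomial in `±x²`; census search with Fejér–Riesz, resultant and kernel-certified explicit-auxiliary-function cuts,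
certified leaf thresholds, trace–Graeffe certificates; `CensusKernelDeg20A … Final`) added to `SubLehmerDegreeTwenty`:
* `lehmer_le_of_irreducible_degree_twenty`, `lehmer_le_of_irreducible_of_natDegree_le_twentyone`,
  `lehmer_le_of_natDegree_le_twentyone` — every `P ∈ ℤ[X]` of degree `≤ 21` with `M(P) > 1` has `M(P) ≥ M(ℓ)`
  (equality at degree 20: `ℓ(x²)`, `ℓ(-x²)` are in the census list);
* `minimalMeasure_degree_twenty` (MRW Table 1 row `D = 20` for PRIMITIVE `P`; `ℓ(±x²)` excluded exactly by primitivity),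
  `minimalMeasureByDegree_le_twenty`;
* `twentytwo_le_natDegree_of_subLehmer` — `1 < M(P) < M(ℓ)` forces `deg P ≥ 22`; rungs `N ≤ 21` of the cell's sub-Lehmer
  ladder and every `HeightCell h s d` with `d ≤ 21`, unconditionally;
* `kernelCensus_le_twentyone` — the census rows at `13/10` for every degree `1 … 21`.
CONTROL rows (published complete lists reach degree 44: Boyd 1980/1989, Mossinghoff 1998, Flammang–Rhin–Sac-Épée 2006,
Mossinghoff–Rhin–Wu 2008); kernel theorems with the standard axioms.
-/

namespace Summit.Ventures.DiscreteObjects.Mahler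

open Polynomial Literature.NumberTheory.MahlerMeasure

/-- An irreducible `P` of degree `20` with `M(P) > 1` has `M(P) ≥ M(ℓ)` (equality for `ℓ(±x²)`). -/
theorem lehmer_le_of_irreducible_degree_twenty {P : ℤ[X]} (hirr : Irreducible P) (hdeg : P.natDegree = 20)
    (h1 : 1 < intMahlerMeasure P) : intMahlerMeasure lehmerPoly ≤ intMahlerMeasure P := by
  have hL : intMahlerMeasure lehmerPoly < 11883 / 10 ^ 4 := lt_trans lehmer_measure_upper_bound (by norm_num)
  by_cases h : intMahlerMeasure P < 13 / 10
  · obtain ⟨l, hl, hform⟩ := degreeCensus_twenty P hdeg hirr h1 h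
    rw [intMahlerMeasure_of_census_form hform]
    exact lehmer_le_census_listed l (by simp only [List.mem_append]; exact Or.inl (Or.inl (Or.inl (Or.inr hl))))
  · push Not at h
    exact le_trans (le_of_lt (lt_trans hL (by norm_num))) h


/-- Lehmer's polynomial in `±x²` is imprimitive: none of `±R(x²)`, `±R(x²)(-x)` is allowed for a primitive `P`. -/
theorem not_primitive_of_comp_sq {P R : ℤ[X]} (hprim : ∀ k : ℕ, 2 ≤ k → ∀ Q : ℤ[X], P ≠ expand ℤ k Q)
    (h : P = R.comp (X ^ 2) ∨ P = -R.comp (X ^ 2) ∨ P = (R.comp (X ^ 2)).comp (-X) ∨ P = -(R.comp (X ^ 2)).comp (-X)) :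
    False := by
  have hc : (R.comp (X ^ 2)).comp (-X) = R.comp (X ^ 2) := by
    rw [comp_assoc]; congr 1; simp [pow_comp]
  rw [hc] at h
  rcases h with h | h | h | h
  · exact hprim 2 le_rfl R (by rw [expand_eq_comp_X_pow, h])
  · exact hprim 2 le_rfl (-R) (by rw [expand_eq_comp_X_pow, h, neg_comp])
  · exact hprim 2 le_rfl R (by rw [expand_eq_comp_X_pow, h])
  · exact hprim 2 le_rfl (-R) (by rw [expand_eq_comp_X_pow, h, neg_comp])

/-- **Degree 20 (MRW Table 1, D = 20):** a PRIMITIVE irreducible `P` of degree `20` with `M(P) > 1` has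
`M(P) ≥ M(mrwMinimalPoly 20) = 1.21282…`; the two imprimitive census entries `ℓ(x²)`, `ℓ(-x²)` (measure `M(ℓ)`) are exactly the
ones excluded by primitivity. -/
theorem minimalMeasure_degree_twenty {P : ℤ[X]} (hirr : Irreducible P) (hdeg : P.natDegree = 20)
    (h1 : 1 < intMahlerMeasure P) (hprim : ∀ k : ℕ, 2 ≤ k → ∀ Q : ℤ[X], P ≠ expand ℤ k Q) :
    intMahlerMeasure (mrwMinimalPoly 20) ≤ intMahlerMeasure P := by
  by_cases h : intMahlerMeasure P < 13 / 10
  · obtain ⟨l, hl, hform⟩ := degreeCensus_twenty P hdeg hirr h1 h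
    rw [intMahlerMeasure_of_census_form hform]
    refine coresDeg20_min l hl ?_ ?_
    · rintro rfl
      rw [ofCoeffs_c20_36_eq] at hform
      exact not_primitive_of_comp_sq hprim hform
    · rintro rfl
      rw [ofCoeffs_c20_37_eq] at hform
      exact not_primitive_of_comp_sq hprim hform
  · push Not at h
    have h20 : intMahlerMeasure (mrwMinimalPoly 20) ≤ intMahlerMeasure (ofCoeffs c20_01) :=
      coresDeg20_min c20_01 (by simp [coresDeg20]) (by decide) (by decide)
    exact le_trans h20 (le_trans (le_of_lt (coresDeg20_measure_bounds c20_01 (by simp [coresDeg20])).2) h)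

/-- **`MinimalMeasureByDegree` for `D ≤ 20` (proved):** for every even `8 ≤ D ≤ 20`, a PRIMITIVE irreducible integer
polynomial of degree `D` with `M > 1` has `M ≥ M(mrwMinimalPoly D)` — the `D = 8, …, 20` rows of MRW's Theorem 1.1 / Table 1
in the Literature file's own terms (primitivity is needed exactly at `D = 20`: `ℓ(±x²)`). -/
theorem minimalMeasureByDegree_le_twenty :
    ∀ D : ℕ, Even D → 8 ≤ D → D ≤ 20 →
      ∀ P : ℤ[X], Irreducible P → P.natDegree = D → 1 < (P.map (Int.castRingHom ℂ)).mahlerMeasure →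
        (∀ k : ℕ, 2 ≤ k → ∀ Q : ℤ[X], P ≠ expand ℤ k Q) →
          ((mrwMinimalPoly D).map (Int.castRingHom ℂ)).mahlerMeasure ≤ (P.map (Int.castRingHom ℂ)).mahlerMeasure := by
  intro D hD h8 h20 P hirr hdeg h1 hprim
  by_cases h18 : D ≤ 18
  · exact minimalMeasureByDegree_le_eighteen D hD h8 h18 P hirr hdeg h1 hprim
  · have hD20 : D = 20 := by
      obtain ⟨k, rfl⟩ := hD; omega
    subst hD20
    exact minimalMeasure_degree_twenty hirr hdeg h1 hprim

/-- **Irreducible polynomials of degree `≤ 21` satisfy Lehmer's bound.** -/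
theorem lehmer_le_of_irreducible_of_natDegree_le_twentyone {P : ℤ[X]} (hirr : Irreducible P)
    (hdeg : P.natDegree ≤ 21) (h1 : 1 < intMahlerMeasure P) :
    intMahlerMeasure lehmerPoly ≤ intMahlerMeasure P := by
  by_cases h19 : P.natDegree ≤ 19
  · exact lehmer_le_of_irreducible_of_natDegree_le_nineteen hirr h19 h1
  by_cases hB : 13 / 10 ≤ intMahlerMeasure P
  · exact le_trans (le_of_lt (lt_trans lehmer_measure_upper_bound (by norm_num))) hB
  push Not at h19 hB
  have hθ : intMahlerMeasure P < smythTheta := lt_trans hB (lt_trans (by norm_num) smythTheta_gt)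
  obtain ⟨-, ⟨j, hj⟩, -⟩ := reciprocal_of_measure_lt_smythTheta hirr h1 hθ
  have hd : P.natDegree = 20 := by omega
  exact lehmer_le_of_irreducible_degree_twenty hirr hd h1

/-- **Lehmer's conjecture holds for every integer polynomial of degree `≤ 21`:** `M(P) > 1 ⇒ M(P) ≥ M(ℓ)`. -/
theorem lehmer_le_of_natDegree_le_twentyone {p : ℤ[X]} (hdeg : p.natDegree ≤ 21) (h1 : 1 < intMahlerMeasure p) :
    intMahlerMeasure lehmerPoly ≤ intMahlerMeasure p := by
  classical
  have hp : p ≠ 0 := by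
    intro h
    rw [h] at h1
    unfold intMahlerMeasure at h1
    rw [Polynomial.map_zero, mahlerMeasure_zero] at h1
    linarith
  obtain ⟨u, hu⟩ := UniqueFactorizationMonoid.factors_prod hp
  obtain ⟨c, hc, hcu⟩ := Polynomial.isUnit_iff.mp u.isUnit
  set F := UniqueFactorizationMonoid.factors p with hF
  have hFirr : ∀ f ∈ F, Irreducible f := fun f hf => UniqueFactorizationMonoid.irreducible_of_factor f hf
  have hMu : intMahlerMeasure (↑u : ℤ[X]) = 1 := by
    rw [← hcu, intMahlerMeasure_C]
    rcases Int.isUnit_iff.mp hc with h | h <;> simp [h]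
  have hMp : intMahlerMeasure p = (F.map intMahlerMeasure).prod := by
    rw [← hu, intMahlerMeasure_mul, hMu, mul_one, intMahlerMeasure_multiset_prod]
  have hdvd : ∀ f ∈ F, f ∣ p := fun f hf => (Multiset.dvd_prod hf).trans ⟨↑u, hu.symm⟩
  have hge1 : ∀ x ∈ F.map intMahlerMeasure, 1 ≤ x := by
    intro x hx
    obtain ⟨f, hf, rfl⟩ := Multiset.mem_map.mp hx
    exact one_le_intMahlerMeasure (hFirr f hf).ne_zero
  have hprod_ge : ∀ x ∈ F.map intMahlerMeasure, x ≤ (F.map intMahlerMeasure).prod := by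
    intro x hx
    obtain ⟨T, hT⟩ := Multiset.exists_cons_of_mem hx
    rw [hT, Multiset.prod_cons]
    have hT1 : 1 ≤ T.prod :=
      Multiset.one_le_prod (fun y hy => hge1 y (by rw [hT]; exact Multiset.mem_cons_of_mem hy))
    have hx0 : 0 ≤ x := le_trans zero_le_one (hge1 x hx)
    nlinarith
  by_contra hlt
  push Not at hlt
  have hall : ∀ x ∈ F.map intMahlerMeasure, x = 1 := by
    intro x hx
    obtain ⟨f, hf, rfl⟩ := Multiset.mem_map.mp hx
    by_contra hne
    have hgt : 1 < intMahlerMeasure f := lt_of_le_of_ne (hge1 _ hx) (Ne.symm hne)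
    have hfdeg : f.natDegree ≤ 21 := (natDegree_le_of_dvd (hdvd f hf) hp).trans hdeg
    have h2 := lehmer_le_of_irreducible_of_natDegree_le_twentyone (hFirr f hf) hfdeg hgt
    have h3 := hprod_ge _ hx
    rw [← hMp] at h3
    linarith
  have : (F.map intMahlerMeasure).prod = 1 := Multiset.prod_eq_one hall
  rw [← hMp] at this
  linarith

/-- **A sub-Lehmer polynomial has degree at least `22`.** -/
theorem twentytwo_le_natDegree_of_subLehmer {P : ℤ[X]} (hP : SubLehmer P) : 22 ≤ P.natDegree := by
  by_contra h
  push Not at h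
  have := lehmer_le_of_natDegree_le_twentyone (p := P) (by omega) hP.1
  exact absurd hP.2 (not_lt.mpr this)

/-- Census rows in the engines' format, degrees `≤ 21`, below Lehmer's measure: nothing. -/
theorem heightBoundedCensus_subLehmer_of_le_twentyone {n h : ℕ} (hn : n ≤ 21) :
    HeightBoundedCensus n h (intMahlerMeasure lehmerPoly) [] := by
  refine ⟨fun p hdeg _ h1 h2 => ?_, fun l hl => by simp at hl⟩
  exfalso
  have := lehmer_le_of_natDegree_le_twentyone (p := p) (by omega) h1
  linarith

/-- **Rungs `N ≤ 21` of the sub-Lehmer ladder, unconditionally, at every height bound `h`.** -/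
theorem heightSubLehmerEmptyUpTo_of_le_twentyone (h : ℕ) {N : ℕ} (hN : N ≤ 21) : HeightSubLehmerEmptyUpTo h N := by
  intro P hdeg _ hP
  have := twentytwo_le_natDegree_of_subLehmer hP
  omega

/-- Height-1 rungs `N ≤ 21`, unconditionally. -/
theorem height1SubLehmerEmptyUpTo_of_le_twentyone {N : ℕ} (hN : N ≤ 21) : Height1SubLehmerEmptyUpTo N :=
  (heightSubLehmerEmptyUpTo_one_iff N).mp (heightSubLehmerEmptyUpTo_of_le_twentyone 1 hN)

/-- Every cell `HeightCell h s d` with core degree `d ≤ 21` holds unconditionally. -/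
theorem heightCell_of_le_twentyone (h : ℕ) (s : Multiset ℕ) {d : ℕ} (hd : d ≤ 21) : HeightCell h s d := by
  intro Q hdeg _ _ _ _ _ hQ
  have := twentytwo_le_natDegree_of_subLehmer hQ
  omega

/-- **The kernel census of small Mahler measures, degrees `1 … 21`, bound `13/10`:** the only irreducible integer
polynomials of degree `n ∈ [1, 21]` with `1 < M < 1.3` are, up to `±x`, the listed cores of degrees `8` (one), `10` (seven),
`12` (five), `14` (eleven), `16` (sixteen), `18` (twenty-three) and `20` (forty-nine listed); every other degree `≤ 21` has none. -/
theorem kernelCensus_le_twentyone :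
    DegreeCensus 8 (13 / 10) coresDeg8 ∧ DegreeCensus 10 (13 / 10) coresDeg10 ∧ DegreeCensus 12 (13 / 10) coresDeg12 ∧
      DegreeCensus 14 (13 / 10) coresDeg14 ∧ DegreeCensus 16 (13 / 10) coresDeg16 ∧ DegreeCensus 18 (13 / 10) coresDeg18 ∧
      DegreeCensus 20 (13 / 10) coresDeg20 ∧
      ∀ n : ℕ, 1 ≤ n → n ≤ 21 → n ≠ 8 → n ≠ 10 → n ≠ 12 → n ≠ 14 → n ≠ 16 → n ≠ 18 → n ≠ 20 →
        DegreeCensus n (13 / 10) [] := by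
  obtain ⟨h8, h10, h12, h14, h16, h18, hrest⟩ := kernelCensus_le_nineteen
  refine ⟨h8, h10, h12, h14, h16, h18, degreeCensus_twenty, ?_⟩
  intro n hn1 hn21 h8' h10' h12' h14' h16' h18' h20'
  by_cases hn19 : n ≤ 19
  · exact hrest n hn1 hn19 h8' h10' h12' h14' h16' h18'
  · have hn : n = 21 := by omega
    subst hn
    have hθ : (13 : ℝ) / 10 ≤ smythTheta := le_of_lt (lt_trans (by norm_num) smythTheta_gt)
    exact degreeCensus_odd_smythTheta (by decide) hθ

end Summit.Ventures.DiscreteObjects.Mahler
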